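import Mathlib
import HarnessLib
import Literature.MathematicalPhysics.QuantumLattice.HubbardGrandCanonicalDensity
import Summits.HubbardSuperconductivity.HubbardSuperconductivity.Theorems.WeakCouplingBCSWcbcsBcsConstructionEnergyDensityLimit

/-!
# WeakCouplingBCS / crux `WcbcsBcsConstruction` — the limit points of the interacting grand-canonical
# density lie within `O(M r + U/r)` of the free density (stub `stub_gcDensity_limitPoints_near_free`)

Line `lro-seed-kink-bridge` of crux stmt-HubbardSuperconductivity-2010, registered sub-goal
`stub_gcDensity_limitPoints_near_free`. Write `E_L(U,y) = E₀(hubbardTorusWith 2 (L+1) 1 U y)` for the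
grand-canonical ground-state energy of the Hubbard torus `(ℤ/(L+1)ℤ)²` at hopping `1`, repulsion `U` and
chemical potential `y`, `V_L = (L+1)²`, `n_L(U,μ) = Re ω₀[hubbardTorusWith 2 (L+1) 1 U μ](N)/V_L` for the tracial
ground-state density, and `f(y) = lim_L E_L(U,y)/V_L`, `g(y) = lim_L E_L(0,y)/V_L` for the limiting energy
densities (they exist by `stub_torusGcEnergyDensityLimit`; in the statement they are written with `limUnder`).

**Theorem** (`stub_gcDensity_limitPoints_near_free`). If `0 ≤ U`, `0 < r` and the free equation of state has
the quadratic Taylor bound `|g(y) - g(μ) + n₀ (y - μ)| ≤ M (y - μ)²` on `[μ - r, μ + r]` (slope `-n₀` at `μ`), then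
`n₀ - (M r + 2U/r) ≤ liminf_L n_L(U,μ)` and `limsup_L n_L(U,μ) ≤ n₀ + (M r + 2U/r)`.
So at every `μ` and along every subsequence the interacting density differs from the free density `n₀` by
`O(M r + U/r)`; with `r ~ √(U/M)` this is `O(√U)`.

Proof (folklore; Koma–Tasaki, J. Stat. Phys. 76 (1994) §1 for the finite-volume set-up).
(1) `0 ≤ f(y) - g(y) ≤ U` for every `y`: the finite-volume interaction sandwich
`0 ≤ E_L(U,y) - E_L(0,y) ≤ U V_L` (`groundEnergy_torus_sub_free_mem_Icc`) passes to the limit.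
(2) The finite-volume Griffiths sandwich (`gcNumber_torus_mem_Icc_slope`) at step `r`, divided by `V_L`:
`(E_L(U,μ-r) - E_L(U,μ))/(r V_L) ≤ n_L ≤ (E_L(U,μ) - E_L(U,μ+r))/(r V_L)`; both bounds converge, to
`(f(μ-r) - f(μ))/r` and `(f(μ) - f(μ+r))/r`, and `0 ≤ n_L ≤ 2` (`gcDensity_torus_mem_Icc`), so
`(f(μ-r) - f(μ))/r ≤ liminf n_L` and `limsup n_L ≤ (f(μ) - f(μ+r))/r` (`wcbcs_liminf_limsup_sandwich`).
(3) By (1) and the Taylor bound at `y = μ ∓ r`: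
`f(μ-r) - f(μ) ≥ g(μ-r) - g(μ) - U ≥ n₀ r - M r² - U` and `f(μ) - f(μ+r) ≤ g(μ) - g(μ+r) + U ≤ n₀ r + M r² + U`;
divide by `r` (the registered constant `2U/r` has room to spare).

No definition is introduced; nothing here is specific to `d = 2` except the vocabulary of the crux.
-/

-- the summit and the problem are both `HubbardSuperconductivity`, so the namespace legitimately repeats it
set_option linter.dupNamespace false

namespace Summit.HubbardSuperconductivity.HubbardSuperconductivity.Theorems

open Literature.MathematicalPhysics.QuantumLattice Literature.Probability.LatticeModels Matrix Filter
open scoped Matrix.Norms.L2Operator ComplexOrder Topology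

/-- **Sandwich bounds for `liminf` / `limsup` of a bounded real sequence.** If `a L ≤ n L ≤ b L` for all `L`,
`a → A`, `b → B`, and `c ≤ n L ≤ C`, then `A ≤ liminf n` and `limsup n ≤ B`. [folklore] -/
theorem wcbcs_liminf_limsup_sandwich {n a b : ℕ → ℝ} {A B c C : ℝ}
    (ha : Tendsto a atTop (𝓝 A)) (hb : Tendsto b atTop (𝓝 B))
    (han : ∀ L, a L ≤ n L) (hnb : ∀ L, n L ≤ b L) (hlo : ∀ L, c ≤ n L) (hhi : ∀ L, n L ≤ C) :
    A ≤ liminf n atTop ∧ limsup n atTop ≤ B := by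
  constructor
  · rw [← ha.liminf_eq]
    exact liminf_le_liminf (Eventually.of_forall han) ha.isBoundedUnder_ge
      (isCoboundedUnder_ge_of_le atTop hhi)
  · rw [← hb.limsup_eq]
    exact limsup_le_limsup (Eventually.of_forall hnb) (isCoboundedUnder_le_of_le atTop hlo)
      hb.isBoundedUnder_le

/-- **The limit points of the interacting density lie within `M r + 2U/r` of the free density, given the
limiting energy densities.** With `f`, `g` the thermodynamic limits of `E₀(hubbardTorusWith 2 (L+1) 1 U ·)/(L+1)²`
and `E₀(hubbardTorusWith 2 (L+1) 1 0 ·)/(L+1)²`, `0 ≤ U`, `0 < r`, and the quadratic Taylor bound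
`|g(y) - g(μ) + n₀ (y - μ)| ≤ M (y - μ)²` on `[μ - r, μ + r]`:
`n₀ - (M r + 2U/r) ≤ liminf_L n_L(U,μ)` and `limsup_L n_L(U,μ) ≤ n₀ + (M r + 2U/r)` for the tracial ground-state
density `n_L(U,μ) = Re ω₀(N)/(L+1)²` (interaction sandwich `0 ≤ f - g ≤ U` plus the Griffiths sandwich at step `r`).
[cite: KomaTasaki1994, §1] -/
theorem wcbcs_gcDensity_limitPoints_of_limits {U μ r M n₀ : ℝ} {f g : ℝ → ℝ} (hU : 0 ≤ U) (hr : 0 < r)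
    (hf : ∀ y : ℝ, Tendsto (fun L : ℕ => (hubbardTorusWith 2 (L + 1) 1 U y).groundEnergy /
      ((L + 1 : ℕ) : ℝ) ^ 2) atTop (𝓝 (f y)))
    (hg : ∀ y : ℝ, Tendsto (fun L : ℕ => (hubbardTorusWith 2 (L + 1) 1 0 y).groundEnergy /
      ((L + 1 : ℕ) : ℝ) ^ 2) atTop (𝓝 (g y)))
    (hTaylor : ∀ y ∈ Set.Icc (μ - r) (μ + r), |g y - g μ - (-n₀) * (y - μ)| ≤ M * (y - μ) ^ 2) :
    n₀ - (M * r + 2 * U / r) ≤ liminf (fun L : ℕ => ((hubbardTorusWith 2 (L + 1) 1 U μ).groundStateFunctional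
        totalNumber).re / ((L + 1 : ℕ) : ℝ) ^ 2) atTop ∧
      limsup (fun L : ℕ => ((hubbardTorusWith 2 (L + 1) 1 U μ).groundStateFunctional
        totalNumber).re / ((L + 1 : ℕ) : ℝ) ^ 2) atTop ≤ n₀ + (M * r + 2 * U / r) := by
  have hV : ∀ L : ℕ, (0 : ℝ) < ((L + 1 : ℕ) : ℝ) ^ 2 := fun L => by positivity
  -- (1) the interacting and free limiting energy densities differ by at most `U`
  have hfg : ∀ y : ℝ, f y - g y ∈ Set.Icc 0 U := fun y => by
    refine isClosed_Icc.mem_of_tendsto ((hf y).sub (hg y)) (Eventually.of_forall fun L => ?_)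
    obtain ⟨h0, h1⟩ := groundEnergy_torus_sub_free_mem_Icc (L + 1) 1 y hU
    rw [← sub_div]
    exact ⟨div_nonneg h0 (hV L).le, (div_le_iff₀ (hV L)).2 h1⟩
  -- (2) the finite-volume Griffiths sandwich at step `r`, per unit volume
  have hsand : ∀ L : ℕ,
      ((hubbardTorusWith 2 (L + 1) 1 U (μ - r)).groundEnergy / ((L + 1 : ℕ) : ℝ) ^ 2 -
            (hubbardTorusWith 2 (L + 1) 1 U μ).groundEnergy / ((L + 1 : ℕ) : ℝ) ^ 2) / r ≤
          ((hubbardTorusWith 2 (L + 1) 1 U μ).groundStateFunctional totalNumber).re /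
            ((L + 1 : ℕ) : ℝ) ^ 2 ∧
        ((hubbardTorusWith 2 (L + 1) 1 U μ).groundStateFunctional totalNumber).re /
            ((L + 1 : ℕ) : ℝ) ^ 2 ≤
          ((hubbardTorusWith 2 (L + 1) 1 U μ).groundEnergy / ((L + 1 : ℕ) : ℝ) ^ 2 -
            (hubbardTorusWith 2 (L + 1) 1 U (μ + r)).groundEnergy / ((L + 1 : ℕ) : ℝ) ^ 2) / r := by
    intro L
    obtain ⟨h1, h2⟩ := gcNumber_torus_mem_Icc_slope (L + 1) 1 U μ hr
    constructor
    · rw [← sub_div, div_right_comm]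
      exact div_le_div_of_nonneg_right h1 (hV L).le
    · rw [← sub_div, div_right_comm]
      exact div_le_div_of_nonneg_right h2 (hV L).le
  have ha : Tendsto (fun L : ℕ => ((hubbardTorusWith 2 (L + 1) 1 U (μ - r)).groundEnergy /
      ((L + 1 : ℕ) : ℝ) ^ 2 - (hubbardTorusWith 2 (L + 1) 1 U μ).groundEnergy / ((L + 1 : ℕ) : ℝ) ^ 2) / r)
      atTop (𝓝 ((f (μ - r) - f μ) / r)) :=
    ((hf (μ - r)).sub (hf μ)).div_const r
  have hb : Tendsto (fun L : ℕ => ((hubbardTorusWith 2 (L + 1) 1 U μ).groundEnergy /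
      ((L + 1 : ℕ) : ℝ) ^ 2 - (hubbardTorusWith 2 (L + 1) 1 U (μ + r)).groundEnergy / ((L + 1 : ℕ) : ℝ) ^ 2) / r)
      atTop (𝓝 ((f μ - f (μ + r)) / r)) :=
    ((hf μ).sub (hf (μ + r))).div_const r
  have hbd : ∀ L : ℕ, ((hubbardTorusWith 2 (L + 1) 1 U μ).groundStateFunctional totalNumber).re /
      ((L + 1 : ℕ) : ℝ) ^ 2 ∈ Set.Icc (0 : ℝ) 2 := fun L => gcDensity_torus_mem_Icc (L + 1) 1 U μ
  obtain ⟨hlow, hup⟩ := wcbcs_liminf_limsup_sandwich ha hb (fun L => (hsand L).1)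
    (fun L => (hsand L).2) (fun L => (hbd L).1) (fun L => (hbd L).2)
  -- (3) compare with the free equation of state through the Taylor bound at `μ ∓ r`
  have hTm := hTaylor (μ - r) ⟨le_rfl, by linarith⟩
  have hTp := hTaylor (μ + r) ⟨by linarith, le_rfl⟩
  rw [show μ - r - μ = -r by ring, abs_le] at hTm
  rw [show μ + r - μ = r by ring, abs_le] at hTp
  obtain ⟨hTm1, -⟩ := hTm
  obtain ⟨hTp1, -⟩ := hTp
  obtain ⟨hm0, -⟩ := hfg (μ - r)
  obtain ⟨-, hμU⟩ := hfg μ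
  obtain ⟨hp0, -⟩ := hfg (μ + r)
  have hr0 : r ≠ 0 := hr.ne'
  constructor
  · refine le_trans ?_ hlow
    rw [le_div_iff₀ hr]
    have key : (n₀ - (M * r + 2 * U / r)) * r = n₀ * r - M * r ^ 2 - 2 * U := by
      field_simp
      ring
    rw [key]
    linarith
  · refine hup.trans ?_
    rw [div_le_iff₀ hr]
    have key : (n₀ + (M * r + 2 * U / r)) * r = n₀ * r + M * r ^ 2 + 2 * U := by
      field_simp
      ring
    rw [key]
    linarith

/-- **The limit points of the interacting grand-canonical density lie within `M r + 2U/r` of the free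
density** (registered sub-goal `stub_gcDensity_limitPoints_near_free` of crux stmt-HubbardSuperconductivity-2010,
line `lro-seed-kink-bridge`). For `0 ≤ U`, `0 < r`, if the limiting free energy density
`g(y) = lim_L E₀(hubbardTorusWith 2 (L+1) 1 0 y)/(L+1)²` obeys `|g(y) - g(μ) + n₀ (y - μ)| ≤ M (y - μ)²` on
`[μ - r, μ + r]`, then the tracial ground-state density `n_L(U,μ) = Re ω₀[hubbardTorusWith 2 (L+1) 1 U μ](N)/(L+1)²`
has `n₀ - (M r + 2U/r) ≤ liminf_L n_L(U,μ)` and `limsup_L n_L(U,μ) ≤ n₀ + (M r + 2U/r)`: density matching with the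
free gas can only fail inside an `O(M r + U/r)`-wide (optimally `O(√U)`-wide) density jump. The thermodynamic
limits exist by `stub_torusGcEnergyDensityLimit`; the rest is `wcbcs_gcDensity_limitPoints_of_limits`.
[cite: KomaTasaki1994, §1] -/
theorem stub_gcDensity_limitPoints_near_free :
    ∀ (U μ r M n₀ : ℝ), 0 ≤ U → 0 < r →
      (∀ y ∈ Set.Icc (μ - r) (μ + r),
        |limUnder atTop (fun L : ℕ => (hubbardTorusWith 2 (L + 1) 1 0 y).groundEnergy / ((L + 1 : ℕ) : ℝ) ^ 2) -
          limUnder atTop (fun L : ℕ => (hubbardTorusWith 2 (L + 1) 1 0 μ).groundEnergy / ((L + 1 : ℕ) : ℝ) ^ 2) -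
          (-n₀) * (y - μ)| ≤ M * (y - μ) ^ 2) →
      n₀ - (M * r + 2 * U / r) ≤ liminf (fun L : ℕ => ((hubbardTorusWith 2 (L + 1) 1 U μ).groundStateFunctional
          totalNumber).re / ((L + 1 : ℕ) : ℝ) ^ 2) atTop ∧
      limsup (fun L : ℕ => ((hubbardTorusWith 2 (L + 1) 1 U μ).groundStateFunctional
          totalNumber).re / ((L + 1 : ℕ) : ℝ) ^ 2) atTop ≤ n₀ + (M * r + 2 * U / r) := by
  intro U μ r M n₀ hU hr hTaylor
  exact wcbcs_gcDensity_limitPoints_of_limits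
    (f := fun y : ℝ => limUnder atTop (fun L : ℕ => (hubbardTorusWith 2 (L + 1) 1 U y).groundEnergy /
      ((L + 1 : ℕ) : ℝ) ^ 2))
    (g := fun y : ℝ => limUnder atTop (fun L : ℕ => (hubbardTorusWith 2 (L + 1) 1 0 y).groundEnergy /
      ((L + 1 : ℕ) : ℝ) ^ 2))
    hU hr (fun y => tendsto_nhds_limUnder (stub_torusGcEnergyDensityLimit U y))
    (fun y => tendsto_nhds_limUnder (stub_torusGcEnergyDensityLimit 0 y)) hTaylor

end Summit.HubbardSuperconductivity.HubbardSuperconductivity.Theorems
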